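import Mathlib.MeasureTheory.Group.Integral
import Mathlib.MeasureTheory.Constructions.Pi
import Mathlib.Analysis.Calculus.ParametricIntegral
import Summits.Ventures.YMGap.Thresholds.LatticeBakryEmeryBochner
import HarnessLib

/-!
# Venture YMGap — multi-link Bakry–Émery calculus, Part D:
# the product Haar measure on `SU(N)^E`, integration by parts, symmetry of the generator,
# and the integrated Bochner inequality

HONEST FRAMING: venture file (cell `pub-ymgap`, track (a), seat p2); measure-theoretic plumbing
towards a kernel proof of the multi-link Bakry–Émery Poincaré inequality for lattice `SU(N)`
Yang–Mills. The proofs are those of the one-link tree file `SUNBakryEmeryPoincare.lean` Part D with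
`SU(N)` replaced by the compact group `SU(N)^E = (E → SU(N))` (product Haar probability measure
`σ^{⊗E} = Measure.pi (fun _ => haarProbability SU(N))`, the reference measure of the tree's
`wilsonWeight`) embedded in the algebra `(E → M_N(ℂ))` by `emb`.

* `exp_smul_lk` : `exp(t · single_e Y) = mulSingle_e exp(tY)` — the flow of the block-frame field
  `D_{(e,α)}` right-multiplies the link `e` by the one-parameter subgroup `exp(t Y_α) ⊆ SU(N)`;
* `integral_algD_eq_zero` : **integration by parts** `∫ D_{(e,Y)} F dσ^{⊗E} = 0`
  (right-invariance of the product Haar measure, differentiated under the integral sign);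
* `integral_mul_exp_mul_genL` : symmetry `∫ F L_S G e^S = -∫ Γ(F,G) e^S`;
* `integral_exp_mul_genL_sq` : integrated Bochner `∫ (L_S u)² e^S = ∫ Γ₂(u) e^S`;
* `integral_exp_mul_Gam_le` : `(N/2 - Λ) ∫ Γ(u,u) e^S ≤ ∫ (L_S u)² e^S` under the Hessian
  hypothesis `|D_V D_V S| ≤ Λ‖V‖²` on `SU(N)^E` (Shen–Zhu–Zhu (4.5)–(4.7)).

## References

* H. Shen, R. Zhu, X. Zhu, CMP 400 (2023) 805–851 = arXiv:2204.12737, (4.1), (4.5)–(4.8).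
* D. Bakry, I. Gentil, M. Ledoux, Grundlehren 348 (2014), §1.16, Prop. 4.8.1.
* Tree file `SUNBakryEmeryPoincare.lean`, Part D.
-/

noncomputable section

open scoped Matrix ComplexConjugate BigOperators Matrix.Norms.Frobenius ContDiff Topology
open Matrix Complex Finset MeasureTheory Filter
open Literature.MathematicalPhysics.QuantumFieldTheory
open Literature.MathematicalPhysics.QuantumFieldTheory.SUNBakryEmery
  (FrameIdx frame frame_conjTranspose frame_trace SUN expSU coe_expSU)

namespace Summit.Ventures.YMGap

namespace LatticeBakryEmery

universe u

variable {ι : Type u} [Fintype ι] [DecidableEq ι] {N : ℕ}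

/-! ### The compact group `SU(N)^E` inside `(E → M_N(ℂ))` -/

/-- `SU(N)^E` as a type: link configurations with values in `SU(N)`. -/
abbrev PSU (ι : Type u) (N : ℕ) : Type u := ι → SUN N

/-- The embedding `SU(N)^E ⊆ (E → M_N(ℂ))` (coordinatewise coercion). -/
def emb (g : PSU ι N) : Cfg ι N := fun e => (g e : Matrix (Fin N) (Fin N) ℂ)

omit [Fintype ι] [DecidableEq ι] in
/-- Components of the embedding. -/
@[simp] theorem emb_apply (g : PSU ι N) (e : ι) : emb g e = (g e : Matrix (Fin N) (Fin N) ℂ) := rfl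

omit [Fintype ι] [DecidableEq ι] in
/-- The embedding is multiplicative. -/
theorem emb_mul (g h : PSU ι N) : emb (g * h) = emb g * emb h := by
  funext e; simp [emb]

omit [Fintype ι] [DecidableEq ι] in
/-- The embedding is continuous. -/
theorem continuous_emb : Continuous (emb : PSU ι N → Cfg ι N) :=
  continuous_pi fun e => continuous_subtype_val.comp (continuous_apply e)

omit [Fintype ι] [DecidableEq ι] in
/-- Each link of an `SU(N)^E` configuration is unitary. -/
theorem emb_mem_unitaryGroup (g : PSU ι N) (e : ι) : emb g e ∈ Matrix.unitaryGroup (Fin N) ℂ :=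
  Matrix.specialUnitaryGroup_le_unitaryGroup (g e).2

/-- The **product Haar probability measure** `σ^{⊗E}` on `SU(N)^E` (the reference measure of the
Wilson weight `wilsonWeight`). -/
abbrev haarPi (ι : Type u) [Fintype ι] (N : ℕ) : Measure (PSU ι N) :=
  Measure.pi fun _ : ι => haarProbability (SUN N)

/-- `σ^{⊗E}` is a probability measure. -/
instance haarPi.isProbabilityMeasure : IsProbabilityMeasure (haarPi ι N) := by
  unfold haarPi; infer_instance

/-- `σ^{⊗E}` is right invariant. -/
instance haarPi.isMulRightInvariant : (haarPi ι N).IsMulRightInvariant :=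
  Measure.pi.isMulRightInvariant _

omit [DecidableEq ι] in
/-- Continuous functions on `SU(N)^E` are integrable for finite measures. -/
theorem integrable_of_continuous_PSU {φ : PSU ι N → ℝ} (hφ : Continuous φ) (μ : Measure (PSU ι N))
    [IsFiniteMeasure μ] : Integrable φ μ :=
  hφ.integrable_of_hasCompactSupport (HasCompactSupport.of_compactSpace _)

omit [Fintype ι] [DecidableEq ι] in
/-- Restrictions of smooth ambient functions are continuous on `SU(N)^E`. -/
theorem continuous_restrict [Fintype ι] {F : Cfg ι N → ℝ} (hF : ContDiff ℝ ∞ F) :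
    Continuous fun g : PSU ι N => F (emb g) :=
  hF.continuous.comp continuous_emb

/-! ### One-parameter subgroups: the flow of `D_{(e,Y)}` moves the link `e` only -/

/-- **`exp(t · single_e Y) = mulSingle_e (exp(tY))`** in the product algebra `(E → M_N(ℂ))`. -/
theorem exp_smul_lk (e : ι) (Y : Matrix (Fin N) (Fin N) ℂ) (t : ℝ) :
    NormedSpace.exp (t • lk (ι := ι) e Y) = Pi.mulSingle e (NormedSpace.exp (t • Y)) := by
  rw [show NormedSpace.exp (t • lk (ι := ι) e Y) = fun i => NormedSpace.exp ((t • lk (ι := ι) e Y) i) from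
    Pi.exp_def _]
  funext i
  by_cases h : i = e
  · subst h; simp [lk]
  · simp [lk, h, Pi.mulSingle, Function.update, NormedSpace.exp_zero]

/-- Along the flow of `single_e Y`, `Y ∈ 𝔰𝔲(N)`, an `SU(N)^E` configuration stays in `SU(N)^E`:
`emb g · exp(t single_e Y) = emb (g · mulSingle_e expSU(tY))`. -/
theorem emb_mul_exp_smul_lk (g : PSU ι N) (e : ι) {Y : Matrix (Fin N) (Fin N) ℂ} (hY : Yᴴ = -Y)
    (hY0 : Y.trace = 0) (t : ℝ) :
    emb g * NormedSpace.exp (t • lk e Y) = emb (g * Pi.mulSingle e (expSU hY hY0 t)) := by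
  rw [exp_smul_lk, emb_mul]
  congr 1
  funext i
  by_cases h : i = e
  · subst h; simp [emb]
  · simp [emb, h]

/-! ### Integration by parts -/

/-- **Integration by parts on `SU(N)^E`**: `∫ D_{single_e Y} F dσ^{⊗E} = 0` for `Y ∈ 𝔰𝔲(N)` — right
invariance of the product Haar measure under `g ↦ g · mulSingle_e exp(tY)`, differentiated at
`t = 0` under the integral sign. -/
theorem integral_algD_eq_zero {F : Cfg ι N → ℝ} (hF : ContDiff ℝ ∞ F) (e : ι)
    {Y : Matrix (Fin N) (Fin N) ℂ} (hY : Yᴴ = -Y) (hY0 : Y.trace = 0) :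
    ∫ g : PSU ι N, algD (lk e Y) F (emb g) ∂(haarPi ι N) = 0 := by
  set μ := haarPi ι N
  set A : Cfg ι N := lk e Y with hA
  set Φ : ℝ → PSU ι N → ℝ := fun t g => F (emb g * NormedSpace.exp (t • A)) with hΦ
  set Φ' : ℝ → PSU ι N → ℝ := fun t g => algD A F (emb g * NormedSpace.exp (t • A)) with hΦ'
  -- `Φ t` is a right translate of `Φ 0`, so its integral is constant
  have hconst : ∀ t, ∫ g, Φ t g ∂μ = ∫ g, Φ 0 g ∂μ := by
    intro t
    have h1 : ∀ g : PSU ι N, Φ t g = Φ 0 (g * Pi.mulSingle e (expSU hY hY0 t)) := by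
      intro g
      simp only [hΦ, zero_smul, NormedSpace.exp_zero, mul_one, hA]
      rw [emb_mul_exp_smul_lk g e hY hY0 t]
    simp_rw [h1]
    exact integral_mul_right_eq_self (fun g => Φ 0 g) (Pi.mulSingle e (expSU hY hY0 t))
  -- continuity
  have hexp : Continuous fun t : ℝ => NormedSpace.exp (t • A) :=
    NormedSpace.exp_continuous.comp (continuous_id.smul continuous_const)
  have hFc : Continuous F := hF.continuous
  have hDFc : Continuous (algD A F) := (contDiff_algD hF A).continuous
  have hflow : Continuous fun p : ℝ × PSU ι N => emb p.2 * NormedSpace.exp (p.1 • A) :=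
    (continuous_emb.comp continuous_snd).mul (hexp.comp continuous_fst)
  have hΦt_cont : ∀ t, Continuous (Φ t) := fun t => hFc.comp (continuous_emb.mul continuous_const)
  have hΦ't_cont : ∀ t, Continuous (Φ' t) := fun t => hDFc.comp (continuous_emb.mul continuous_const)
  have hΦ'_cont : Continuous fun p : ℝ × PSU ι N => Φ' p.1 p.2 := hDFc.comp hflow
  -- a uniform bound for `Φ'` on `[-1, 1] × SU(N)^E` by compactness
  obtain ⟨C, hC⟩ : ∃ C, ∀ p ∈ (Metric.closedBall (0 : ℝ) 1) ×ˢ (Set.univ : Set (PSU ι N)), ‖Φ' p.1 p.2‖ ≤ C :=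
    ((isCompact_closedBall (0 : ℝ) 1).prod isCompact_univ).exists_bound_of_continuousOn hΦ'_cont.continuousOn
  -- pointwise derivative along the flow
  have hderiv : ∀ (g : PSU ι N) (t : ℝ), HasDerivAt (fun s => Φ s g) (Φ' t g) t := fun g t =>
    hasDerivAt_comp_mul_exp hF (emb g) A t
  -- differentiate under the integral sign at `t = 0`
  have hmain := hasDerivAt_integral_of_dominated_loc_of_deriv_le (μ := μ) (F := Φ) (F' := Φ')
    (x₀ := (0 : ℝ)) (s := Metric.ball 0 1) (bound := fun _ => C) (Metric.ball_mem_nhds 0 one_pos)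
    (Eventually.of_forall fun t => (hΦt_cont t).aestronglyMeasurable)
    (integrable_of_continuous_PSU (hΦt_cont 0) μ) (hΦ't_cont 0).aestronglyMeasurable
    (ae_of_all _ fun g t ht => hC (t, g) ⟨Metric.ball_subset_closedBall ht, Set.mem_univ _⟩)
    (integrable_const C) (ae_of_all _ fun g t _ => hderiv g t)
  have hzero : HasDerivAt (fun t => ∫ g, Φ t g ∂μ) 0 0 := by
    have : (fun t => ∫ g, Φ t g ∂μ) = fun _ => ∫ g, Φ 0 g ∂μ := funext hconst
    rw [this]
    exact hasDerivAt_const _ _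
  have heq : ∫ g, Φ' 0 g ∂μ = 0 := hmain.2.unique hzero
  simpa [hΦ'] using heq

/-- IBP for the block-frame directions. -/
theorem integral_algD_bframe_eq_zero (hN : N ≠ 0) {F : Cfg ι N → ℝ} (hF : ContDiff ℝ ∞ F) (a : BIdx ι N) :
    ∫ g : PSU ι N, algD (bframe a) F (emb g) ∂(haarPi ι N) = 0 :=
  integral_algD_eq_zero hF a.1 (frame_conjTranspose a.2) (frame_trace hN a.2)

/-! ### Symmetry of the generator with respect to `e^{S} dσ^{⊗E}` -/

section Symmetry

/-- `e^{S} L_S F = ∑_a D_a (e^{S} D_a F)` (pointwise). -/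
theorem exp_mul_genL_eq_sum {S F : Cfg ι N → ℝ} (hS : ContDiff ℝ ∞ S) (hF : ContDiff ℝ ∞ F) (Q : Cfg ι N) :
    Real.exp (S Q) * genL S F Q = ∑ a : BIdx ι N, algD (bframe a) (fun Q => Real.exp (S Q) * algD (bframe a) F Q) Q := by
  have h : ∀ a : BIdx ι N, algD (bframe a) (fun Q => Real.exp (S Q) * algD (bframe a) F Q) Q =
      Real.exp (S Q) * algD (bframe a) (algD (bframe a) F) Q +
        algD (bframe a) F Q * (Real.exp (S Q) * algD (bframe a) S Q) := by
    intro a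
    rw [algD_fun_mul (hS.exp) (contDiff_algD hF _), algD_exp hS]
  show Real.exp (S Q) * ((∑ a : BIdx ι N, algD (bframe a) (algD (bframe a) F) Q) +
    ∑ a : BIdx ι N, algD (bframe a) S Q * algD (bframe a) F Q) = _
  simp_rw [h]
  rw [sum_add_distrib, mul_add, mul_sum, mul_sum]
  congr 1
  exact sum_congr rfl fun a _ => by ring

/-- `D_a (F e^{S} D_a G)` summed: `F e^{S} L_S G + e^{S} Γ(F, G)`. -/
theorem mul_exp_mul_genL_add_eq_sum {S F G : Cfg ι N → ℝ} (hS : ContDiff ℝ ∞ S)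
    (hF : ContDiff ℝ ∞ F) (hG : ContDiff ℝ ∞ G) (Q : Cfg ι N) :
    F Q * (Real.exp (S Q) * genL S G Q) + Real.exp (S Q) * Gam F G Q =
      ∑ a : BIdx ι N, algD (bframe a) (fun Q => F Q * (Real.exp (S Q) * algD (bframe a) G Q)) Q := by
  have h : ∀ a : BIdx ι N, algD (bframe a) (fun Q => F Q * (Real.exp (S Q) * algD (bframe a) G Q)) Q =
      F Q * algD (bframe a) (fun Q => Real.exp (S Q) * algD (bframe a) G Q) Q +
        Real.exp (S Q) * algD (bframe a) G Q * algD (bframe a) F Q := by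
    intro a
    rw [algD_fun_mul hF (hS.exp.mul (contDiff_algD hG _))]
  simp only [h, sum_add_distrib, ← mul_sum, ← exp_mul_genL_eq_sum hS hG, Gam]
  rw [mul_sum]
  congr 1
  exact sum_congr rfl fun a _ => by ring

end Symmetry

/-- **`∫ L_S F · e^{S} dσ^{⊗E} = 0`**. -/
theorem integral_exp_mul_genL_eq_zero (hN : N ≠ 0) {S F : Cfg ι N → ℝ} (hS : ContDiff ℝ ∞ S)
    (hF : ContDiff ℝ ∞ F) :
    ∫ g : PSU ι N, Real.exp (S (emb g)) * genL S F (emb g) ∂(haarPi ι N) = 0 := by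
  simp_rw [exp_mul_genL_eq_sum hS hF]
  rw [integral_finsetSum _ fun a _ => integrable_of_continuous_PSU
    (continuous_restrict (contDiff_algD (hS.exp.mul (contDiff_algD hF _)) _)) _]
  exact sum_eq_zero fun a _ => integral_algD_bframe_eq_zero hN (hS.exp.mul (contDiff_algD hF _)) a

/-- **Symmetry / integration by parts for `L_S`**: `∫ F · L_S G · e^{S} = -∫ Γ(F, G) e^{S}`. -/
theorem integral_mul_exp_mul_genL (hN : N ≠ 0) {S F G : Cfg ι N → ℝ} (hS : ContDiff ℝ ∞ S)
    (hF : ContDiff ℝ ∞ F) (hG : ContDiff ℝ ∞ G) :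
    ∫ g : PSU ι N, F (emb g) * (Real.exp (S (emb g)) * genL S G (emb g)) ∂(haarPi ι N) =
      -∫ g : PSU ι N, Real.exp (S (emb g)) * Gam F G (emb g) ∂(haarPi ι N) := by
  rw [eq_neg_iff_add_eq_zero, ← integral_add]
  · simp_rw [mul_exp_mul_genL_add_eq_sum hS hF hG]
    rw [integral_finsetSum _ fun a _ => integrable_of_continuous_PSU
      (continuous_restrict (contDiff_algD (hF.mul (hS.exp.mul (contDiff_algD hG _))) _)) _]
    exact sum_eq_zero fun a _ => integral_algD_bframe_eq_zero hN (hF.mul (hS.exp.mul (contDiff_algD hG _))) a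
  · exact integrable_of_continuous_PSU (continuous_restrict (hF.mul (hS.exp.mul (contDiff_genL hS hG)))) _
  · exact integrable_of_continuous_PSU (continuous_restrict (hS.exp.mul (contDiff_Gam hF hG))) _

/-- **Integrated Bochner formula**: `∫ (L_S u)² e^{S} dσ^{⊗E} = ∫ Γ₂(u) e^{S} dσ^{⊗E}`. -/
theorem integral_exp_mul_genL_sq (hN : N ≠ 0) {S u : Cfg ι N → ℝ} (hS : ContDiff ℝ ∞ S)
    (hu : ContDiff ℝ ∞ u) :
    ∫ g : PSU ι N, Real.exp (S (emb g)) * genL S u (emb g) ^ 2 ∂(haarPi ι N) =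
      ∫ g : PSU ι N, Real.exp (S (emb g)) * Gam2 S u (emb g) ∂(haarPi ι N) := by
  have h1 : ∫ g : PSU ι N, Real.exp (S (emb g)) * genL S (Gam u u) (emb g) ∂(haarPi ι N) = 0 :=
    integral_exp_mul_genL_eq_zero hN hS (contDiff_Gam hu hu)
  have h2 := integral_mul_exp_mul_genL hN hS (contDiff_genL hS hu) hu
  have h3 : ∫ g : PSU ι N, Real.exp (S (emb g)) * Gam2 S u (emb g) ∂(haarPi ι N) =
      (1 / 2) * ∫ g : PSU ι N, Real.exp (S (emb g)) * genL S (Gam u u) (emb g) ∂(haarPi ι N) -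
        ∫ g : PSU ι N, Real.exp (S (emb g)) * Gam (genL S u) u (emb g) ∂(haarPi ι N) := by
    rw [← integral_const_mul, ← integral_sub]
    · refine integral_congr_ae (ae_of_all _ fun g => ?_)
      simp only [Gam2, Gam_comm u (genL S u)]
      ring
    · exact (integrable_of_continuous_PSU (continuous_restrict (hS.exp.mul (contDiff_genL hS
        (contDiff_Gam hu hu)))) _).const_mul _
    · exact integrable_of_continuous_PSU (continuous_restrict (hS.exp.mul (contDiff_Gam (contDiff_genL hS hu) hu))) _
  rw [h3, h1, mul_zero, zero_sub, ← h2]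
  refine integral_congr_ae (ae_of_all _ fun g => ?_)
  simp only
  ring

/-- The **Hessian hypothesis** on `SU(N)^E`: `|D_V D_V S (Q)| ≤ Λ ∑_e ‖V_e‖_F²` for every
`Q ∈ SU(N)^E` and every `V ∈ 𝔰𝔲(N)^E` (for the Wilson action at 't Hooft coupling `β`, the venture's
kernel theorem "Hessian ≤ 4d" gives `Λ = 4dN|β|`). -/
def HessBound (S : Cfg ι N → ℝ) (Λ : ℝ) : Prop :=
  ∀ (g : PSU ι N) (V : Cfg ι N), (∀ e, (V e)ᴴ = -V e) → (∀ e, (V e).trace = 0) →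
    |algD V (algD V S) (emb g)| ≤ Λ * ∑ e, frobNorm (V e) ^ 2

/-- **Integrated curvature-dimension inequality** on `SU(N)^E` (Shen–Zhu–Zhu (4.5)–(4.7) with the
Hessian constant as a hypothesis): `(N/2 - Λ) ∫ Γ(u,u) e^{S} dσ^{⊗E} ≤ ∫ (L_S u)² e^{S} dσ^{⊗E}`. -/
theorem integral_exp_mul_Gam_le (hN : N ≠ 0) {S : Cfg ι N → ℝ} (hS : ContDiff ℝ ∞ S) {Λ : ℝ}
    (hHess : HessBound S Λ) {u : Cfg ι N → ℝ} (hu : ContDiff ℝ ∞ u) :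
    ((N : ℝ) / 2 - Λ) * ∫ g : PSU ι N, Real.exp (S (emb g)) * Gam u u (emb g) ∂(haarPi ι N) ≤
      ∫ g : PSU ι N, Real.exp (S (emb g)) * genL S u (emb g) ^ 2 ∂(haarPi ι N) := by
  rw [integral_exp_mul_genL_sq hN hS hu, ← integral_const_mul]
  refine integral_mono ?_ ?_ fun g => ?_
  · exact (integrable_of_continuous_PSU (continuous_restrict (hS.exp.mul (contDiff_Gam hu hu))) _).const_mul _
  · have hc : ContDiff ℝ ∞ (Gam2 S u) := by
      have : Gam2 S u = fun Q => (1 / 2) * genL S (Gam u u) Q - Gam u (genL S u) Q := rfl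
      rw [this]
      exact (contDiff_const.mul (contDiff_genL hS (contDiff_Gam hu hu))).sub (contDiff_Gam hu (contDiff_genL hS hu))
    exact integrable_of_continuous_PSU (continuous_restrict (hS.exp.mul hc)) _
  · have h := Gam2_ge_of_hess hN hS hu (emb g) (hHess g)
    have hpos := Real.exp_pos (S (emb g))
    calc ((N : ℝ) / 2 - Λ) * (Real.exp (S (emb g)) * Gam u u (emb g))
        = Real.exp (S (emb g)) * (((N : ℝ) / 2 - Λ) * Gam u u (emb g)) := by ring
      _ ≤ Real.exp (S (emb g)) * Gam2 S u (emb g) := mul_le_mul_of_nonneg_left h hpos.le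

end LatticeBakryEmery

end Summit.Ventures.YMGap
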